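import Mathlib.Topology.Algebra.ClopenNhdofOne
import Mathlib.RingTheory.Nilpotent.Defs
import Mathlib.Algebra.Ring.GeomSum
import Mathlib.Algebra.Module.LinearMap.End
import Literature.AlgebraicGeometry.Frobenioids.Categories
import Literature.AnabelianGeometry.SemiGraphs.PSCFundamentalGroup
import HarnessLib

/-!
# [IUTchI] Corollary 2.3 (iii), "`Δ̂_{X,ℍ}` is slim": the three pieces of general group theory its proof uses

Mochizuki, *Inter-universal Teichmüller theory I: construction of Hodge theaters*, kurims
manuscript (May 2020), §2, Corollary 2.3 (iii) p. 47, proof p. 48 l. 30 – p. 49 l. 32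
[cite: Mochizuki2012, Cor 2.3(iii) pp.47-49] (D-0012 claim key; series status DISPUTED; nothing of
the series is asserted here).  PROOF-ONLY toolkit (no definitions) for the companion
`TemperedCoveringsSlimness.lean` of abc-iut-L5-t1's `TemperedCoverings.lean` (p405450), in the
manner of abc-iut-L5-t11's `CommensuratorLemmas.lean`: the printed proof of the slimness of
`Δ̂_{X,ℍ}` passes over three pieces of plain group theory / topology, PROVED here for arbitrary
groups so that the companion can spend its hypotheses on the genuinely arithmetic inputs only:

* `isSlimGroup_subgroup_of_openNormal` — slimness of a subgroup `K` of a profinite group `P` is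
  detected on the traces `J ∩ K` of the open normal subgroups `J ⊆ P` ("Let `J ⊆ Δ̂_X` be a normal
  open subgroup. Write `J_ℍ := J ∩ Δ̂_{X,ℍ}` … suppose that `α ∈ Δ̂_{X,ℍ}` commutes with `J_ℍ`",
  p. 48), with `eq_one_of_forall_mem_openNormalSubgroup` ("since `J` … is arbitrary, … `α` is the
  identity", p. 49);
* `map_eq_top_of_proSigma_of_proL` — the group theory of (†) in case (a): if `G/N` is pro-`Σ` and
  `G ↠ L` is a continuous surjection onto a profinite pro-`l` group, `l ∉ Σ`, then `N ↠ L` ("since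
  `l ∉ Σ`, and `Ker(J_v ⊆ J ⊆ Δ̂_X ↠ Π̂_𝔾) ⊆ J_v ∩ J_ℍ`, it follows that `J_v ∩ J_ℍ` … surjects onto
  the maximal pro-`l` quotient of `J_v`", p. 49) — pro-`Σ` in the tree's sense
  `Literature.AnabelianGeometry.SemiGraphs.IsProSigma` ([CombGC] Def. 1.1 (ii));
* `moduleEnd_eq_one_of_isNilpotent_sub_one_of_pow_eq_one` — "a unipotent automorphism of finite
  order, hence … acts trivially" (p. 49) for endomorphisms of a TORSION-FREE abelian group (the
  integral form needed for `(J*)^{ab}`; the tree's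
  `Literature.RepresentationTheory.Semisimple.eq_one_of_pow_eq_one_of_isNilpotent_sub_one` is the
  version over a field of characteristic `0`).

Slimness is `Literature.AlgebraicGeometry.Frobenioids.IsSlimGroup` ([FrdI] §0), as in the statement
file.  Nothing here bears on [IUTchIII] Cor. 3.12; typed ≠ discharged.
-/

namespace Literature.IUT.HodgeTheaters

open Pointwise Topology
open Literature.AlgebraicGeometry.Frobenioids (IsSlimGroup)
open Literature.AnabelianGeometry.SemiGraphs (IsProSigma)

/-! ### A. Three pieces of general group theory the printed proof uses in passing -/

section General

/-- Slimness of a subgroup `K` of a profinite group `P` (for the subspace topology) is detected on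
the traces `U ∩ K` of the open normal subgroups `U` of `P`: if every `a ∈ K` commuting with `U ∩ K`
is trivial, for all such `U`, then `K` is slim.  (The open subgroups of `K` are the traces of open
subsets of `P`, and the open normal subgroups of a profinite group form a basis of neighbourhoods
of `1`.)  Used for `K = Δ̂_{X,ℍ} ⊆ P = Δ̂_X`, `U = J` in the proof of [IUTchI] Cor. 2.3 (iii), p. 48:
"Let `J ⊆ Δ̂_X` be a normal open subgroup. Write `J_ℍ := J ∩ Δ̂_{X,ℍ}` … Now suppose that
`α ∈ Δ̂_{X,ℍ}` commutes with `J_ℍ`." [cite: Mochizuki2012, Cor 2.3(iii) p.48] -/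
theorem isSlimGroup_subgroup_of_openNormal {P : Type*} [Group P] [TopologicalSpace P]
    [IsTopologicalGroup P] [CompactSpace P] [TotallyDisconnectedSpace P] (K : Subgroup P)
    (h : ∀ U : OpenNormalSubgroup P, ∀ a ∈ K, (∀ x ∈ U, x ∈ K → a * x = x * a) → a = 1) :
    IsSlimGroup K := by
  refine ⟨fun V hV => ?_⟩
  rw [eq_bot_iff]
  intro a ha
  obtain ⟨O, hO, hOV⟩ : ∃ O : Set P, IsOpen O ∧ Subtype.val ⁻¹' O = (V : Set K) :=
    isOpen_induced_iff.mp hV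
  have h1O : (1 : P) ∈ O := by
    have h1 : (1 : K) ∈ Subtype.val ⁻¹' O := by rw [hOV]; exact one_mem V
    exact h1
  obtain ⟨U, hU⟩ := ProfiniteGrp.exist_openNormalSubgroup_sub_open_nhds_of_one hO h1O
  have key : (a : P) = 1 := by
    refine h U a a.2 fun x hxU hxK => ?_
    have hxV : (⟨x, hxK⟩ : K) ∈ V := by
      have : (⟨x, hxK⟩ : K) ∈ Subtype.val ⁻¹' O := hU hxU
      rwa [hOV] at this
    have := (Subgroup.mem_centralizer_iff.mp ha) ⟨x, hxK⟩ hxV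
    simpa using congrArg Subtype.val this.symm
  exact Subgroup.mem_bot.mpr (Subtype.ext key)

/-- In a profinite group an element lying in every open normal subgroup is trivial ("since `J` … is
arbitrary, we thus conclude … that `α` is the identity element", p. 49; the same four lines as the
tree's `Literature.AnabelianGeometry.EtaleTheta.DiscreteNormalizers.eq_one_of_forall_mem_openNormalSubgroup`,
repeated here so as not to import the [EtTh] §2 discharge chain into [IUTchI] §2).
[cite: Mochizuki2012, Cor 2.3(iii) p.49] -/
theorem eq_one_of_forall_mem_openNormalSubgroup {P : Type*} [Group P] [TopologicalSpace P]
    [IsTopologicalGroup P] [CompactSpace P] [TotallyDisconnectedSpace P] {a : P}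
    (h : ∀ U : OpenNormalSubgroup P, a ∈ U) : a = 1 := by
  by_contra ha
  obtain ⟨U, hU⟩ := ProfiniteGrp.exist_openNormalSubgroup_sub_open_nhds_of_one
    (isOpen_compl_singleton (x := a)) (by simpa using fun h1 => ha h1.symm)
  exact hU (h U) rfl

/-- **"(†)", elementary case, the group theory** (proof of [IUTchI] Cor. 2.3 (iii), p. 48–49: "it
follows immediately from the definitions that the image of the homomorphism `J_v ⊆ J ⊆ Δ̂_X ↠ Π̂_𝔾`
is pro-`Σ`; in particular, since `l ∉ Σ`, and `Ker(J_v ⊆ J ⊆ Δ̂_X ↠ Π̂_𝔾) ⊆ J_v ∩ J_ℍ`, it follows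
that `J_v ∩ J_ℍ` … surjects onto the maximal pro-`l` quotient of `J_v`").  Abstractly: let `N ⊴ G`
be such that every open normal subgroup of `G` containing `N` has index divisible only by primes
of `Σ` [i.e. `G/N` is pro-`Σ`], and `q : G ↠ L` a continuous surjection onto a profinite pro-`l`
group, `l ∉ Σ`; if `q(N)` is closed, then `q(N) = L`. [cite: Mochizuki2012, Cor 2.3(iii) p.48] -/
theorem map_eq_top_of_proSigma_of_proL {G L : Type*} [Group G] [TopologicalSpace G]
    [Group L] [TopologicalSpace L] [IsTopologicalGroup L] [CompactSpace L]
    [TotallyDisconnectedSpace L] {Sig : Set ℕ} {l : ℕ} (hl : l ∉ Sig)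
    (N : Subgroup G) [N.Normal]
    (hSig : ∀ M : Subgroup G, M.Normal → IsOpen (M : Set G) → N ≤ M →
      ∀ p : ℕ, p.Prime → p ∣ M.index → p ∈ Sig)
    (q : G →* L) (hqc : Continuous q) (hqs : Function.Surjective q) (hL : IsProSigma {l} L)
    (hNc : IsClosed ((N.map q : Subgroup L) : Set L)) : N.map q = ⊤ := by
  by_contra hne
  obtain ⟨x, hx⟩ : ∃ x : L, x ∉ N.map q :=
    not_forall.mp fun hall => hne (eq_top_iff.mpr fun x _ => hall x)
  haveI hNq : (N.map q).Normal := Subgroup.Normal.map inferInstance q hqs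
  -- an open normal `U ⊆ L` with `x ∉ q(N)·U`
  set W : Set L := (fun u : L => x * u⁻¹) ⁻¹' ((N.map q : Set L)ᶜ) with hW
  have hWo : IsOpen W := hNc.isOpen_compl.preimage (continuous_const.mul continuous_inv)
  have h1W : (1 : L) ∈ W := by simpa [hW] using hx
  obtain ⟨U, hU⟩ := ProfiniteGrp.exist_openNormalSubgroup_sub_open_nhds_of_one hWo h1W
  set M' : Subgroup L := N.map q ⊔ U.toSubgroup with hM'
  haveI hM'n : M'.Normal := Subgroup.sup_normal _ _
  have hM'o : IsOpen (M' : Set L) := Subgroup.isOpen_mono le_sup_right U.isOpen'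
  have hxM' : x ∉ M' := by
    intro hxm
    have hxm' : x ∈ ((N.map q : Subgroup L) : Set L) * (U.toSubgroup : Set L) := by
      rw [← Subgroup.mul_normal]; exact hxm
    obtain ⟨n, hn, u, hu, rfl⟩ := Set.mem_mul.mp hxm'
    have : u ∈ W := hU hu
    simp only [hW, Set.mem_preimage, Set.mem_compl_iff, SetLike.mem_coe, mul_inv_cancel_right]
      at this
    exact this hn
  haveI : Finite (L ⧸ M') := Subgroup.quotient_finite_of_isOpen M' hM'o
  have hidx1 : M'.index ≠ 1 := fun h1 => hxM' (by rw [Subgroup.index_eq_one.mp h1]; trivial)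
  obtain ⟨p, hp, hpd⟩ := Nat.exists_prime_and_dvd hidx1
  have hpl : p ∈ ({l} : Set ℕ) :=
    hL.prime_mem { toSubgroup := M', isOpen' := hM'o, isNormal' := hM'n }
      (inferInstanceAs (Finite (L ⧸ M'))) p hp hpd
  rw [Set.mem_singleton_iff] at hpl
  subst hpl
  -- pull back to `G`: `M := q⁻¹(M')` is open, normal, contains `N`, and has the same index
  have hM : N ≤ M'.comap q := (Subgroup.le_comap_map q N).trans (Subgroup.comap_mono le_sup_left)
  haveI : (M'.comap q).Normal := Subgroup.Normal.comap hM'n q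
  have hidx : (M'.comap q).index = M'.index := M'.index_comap_of_surjective hqs
  exact hl (hSig (M'.comap q) inferInstance (hM'o.preimage hqc) hM p hp (hidx ▸ hpd))

/-- **"a unipotent automorphism of finite order, hence … trivial"** (proof of [IUTchI] Cor. 2.3
(iii), p. 49: "`α` acts on the abelianization `(J*)^{ab}` of `J*` as a unipotent automorphism of
finite order, hence that `α` acts trivially on `(J*)^{ab}`") — the algebra: an endomorphism `φ` of a
torsion-free abelian group with `φ - 1` nilpotent and `φ^n = 1`, `n ≥ 1`, is the identity (the
INTEGRAL form needed for `(J*)^{ab}`, a torsion-free `ℤ̂^{Σ*}`-module; the tree's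
`Literature.RepresentationTheory.Semisimple.eq_one_of_pow_eq_one_of_isNilpotent_sub_one` is the
version over a field of characteristic `0`).  Proof: `0 = φ^n - 1 = g·ν` with `ν = φ - 1`,
`g = Σ_{i<n} φ^i = n + S·ν`; if `ν^{m+2} = 0` then `0 = g·ν^{m+1} = n·ν^{m+1}`, so `ν^{m+1} = 0`
by torsion-freeness — descend to `ν = 0`. [cite: Mochizuki2012, Cor 2.3(iii) p.49] -/
theorem moduleEnd_eq_one_of_isNilpotent_sub_one_of_pow_eq_one {A : Type*} [AddCommGroup A]
    [IsAddTorsionFree A] {φ : Module.End ℤ A} (hnil : IsNilpotent (φ - 1)) {n : ℕ} (hn : n ≠ 0)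
    (hpow : φ ^ n = 1) : φ = 1 := by
  set ν : Module.End ℤ A := φ - 1 with hν
  have hc : Commute φ ν := (Commute.refl φ).sub_right (Commute.one_right φ)
  -- `g · ν = 0` where `g = 1 + φ + ⋯ + φ^{n-1} = n + S·ν`
  set g : Module.End ℤ A := ∑ i ∈ Finset.range n, φ ^ i with hg
  set S : Module.End ℤ A := ∑ i ∈ Finset.range n, ∑ j ∈ Finset.range i, φ ^ j with hS
  have hgν : g * ν = 0 := by rw [hg, hν, geom_sum_mul, hpow, sub_self]
  have hgS : g = (n : Module.End ℤ A) + S * ν := by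
    have h1 : S * ν = ∑ i ∈ Finset.range n, (φ ^ i - 1) := by
      rw [hS, Finset.sum_mul]
      refine Finset.sum_congr rfl fun i _ => ?_
      rw [hν, geom_sum_mul]
    rw [h1, Finset.sum_sub_distrib, Finset.sum_const, Finset.card_range, nsmul_eq_mul, mul_one,
      hg]
    abel
  have hSc : Commute S ν := by
    refine Commute.sum_left _ _ _ fun i _ => Commute.sum_left _ _ _ fun j _ => hc.pow_left j
  -- descent: `ν^{m+2} = 0 ⇒ ν^{m+1} = 0`
  have key : ∀ m : ℕ, ν ^ (m + 2) = 0 → ν ^ (m + 1) = 0 := by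
    intro m hm
    have h1 : (n : Module.End ℤ A) * ν ^ (m + 1) = 0 := by
      have h2 : g * ν ^ (m + 1) = 0 := by
        rw [pow_succ', ← mul_assoc, hgν, zero_mul]
      rw [hgS, add_mul, mul_assoc, ← pow_succ', hm, mul_zero, add_zero] at h2
      exact h2
    ext a
    have h3 : n • (ν ^ (m + 1)) a = 0 := by
      have := congrArg (fun T : Module.End ℤ A => T a) h1
      simpa [Module.End.natCast_apply] using this
    exact (smul_eq_zero.mp h3).resolve_left hn
  obtain ⟨k, hk⟩ := hnil
  have hk2 : ν ^ (k + 2) = 0 := by rw [pow_add, hk, zero_mul]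
  have hdesc : ∀ m : ℕ, ν ^ (m + 2) = 0 → ν ^ 1 = 0 := by
    intro m
    induction m with
    | zero => exact fun h => key 0 h
    | succ m ih => exact fun h => ih (key (m + 1) h)
  have hν0 : ν = 0 := by simpa using hdesc k hk2
  rw [hν, sub_eq_zero] at hν0
  exact hν0

end General

end Literature.IUT.HodgeTheaters
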